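import Literature.NumberTheory.EllipticCurves.PadicSigmaSqUniquenessProofs
import HarnessLib

/-!
# Perrin-Riou's CM sigma and theta functions `σ_v`, `θ_v = Δ·σ_v¹²` (Mém. SMF 17, Ch. III §1.2) in the
# tree's differential-equation currency; `X₀(49)` at `v | 2`: `s₂ = 1/4` is FORCED by integrality

Topic `NumberTheory/EllipticCurves`. Two DEFINITIONS with bodies and their proved API; no named fact.

Perrin-Riou [Perrin-Riou 1984, Ch. III §1.2, p. 53; = Perrin-Riou 1982, §2] fixes a model
`y² + a₁xy + a₃y = x³ + a₂x² + a₄x + a₆` with good reduction at the place `v | p`, the formal logarithm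
`L_v` and its inverse `ℰ_v`, and defines

  `P_v(z) = x(ℰ_v(z)) + (a₁² + 4a₂)/12 = 1/z² + Σ_{k ≥ 2} γ_k z^{2k-2}`,
  `σ_v(z) = z·exp(-(s₂/2)z² - Σ_{k ≥ 2} γ_k z^{2k}/(2k(2k-1)))`,  `θ_v(z) = Δ·σ_v(z)¹²`

(Perrin-Riou 1982, §2, prints `θ_v(z) = Δz¹²exp(-6s₂z² - 12Σ_{k≥2} γ_k z^{2k}/(2k(2k-1)))` directly), where
`s₂ = s₂(𝓛) = lim_{s→0} Σ_{ω ∈ 𝓛∖0} ω̄⁻²|ω|^{-2s}` is the CM constant of the period lattice (an element of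
the field of definition; table p. 54: `s₂ = 1/2` for `y² = 4x³ - 35x - 49`, `K = ℚ(√-7)`). Differentiating
twice, `σ_v` is characterised among series `z + O(z²)` ODD in `z` by

  `-(d/dz)² log σ_v(z) = P_v(z) + s₂ = x + b₂/12 + s₂`,

i.e. — read on the formal group through `z = L_v(t)`, where `d/dz` is the invariant derivation `D = d/ω`
and `z ↦ -z` is the formal inverse — `σ_v(L_v(t))` is THE normalised odd solution of the tree's sigma
equation `x + c = -D(Dσ/σ)` (`WeierstrassCurve.SatisfiesSigmaODE`, `IsFormallyOdd`) with constant
**`c = b₂/12 + s₂`**. Such a solution exists and is unique for EVERY `c` over any `ℚ_p`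
(`exists_isFormallyOdd_satisfiesSigmaODE_zero` twisted by `exp(-(c/2)log²)`;
`eq_of_satisfiesSigmaODE_of_isFormallyOdd`). Hence the definitions of this file:

* `WeierstrassCurve.formalSigma V c` — THE normalised odd formal solution of the sigma equation with
  constant `c` (by choice + uniqueness; `formalSigma_spec`, `eq_formalSigma`); Mazur–Tate's `σ_p` is
  `formalSigma V c_p` whenever the Mazur–Tate pair exists (`padicSigma_eq_formalSigma`).
* `WeierstrassCurve.perrinRiouSigma V s₂ := formalSigma V (b₂/12 + s₂)` and
  `WeierstrassCurve.perrinRiouTheta V s₂ := C Δ · (perrinRiouSigma V s₂)¹²` — `σ_v(L_v(t))` and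
  `θ_v(L_v(t))` as formal series in `t`, for a GIVEN value of the printed constant `s₂` (the tree cannot
  define the transcendental `s₂(𝓛)`; consumers supply the printed value).

and, for `X₀(49) = 49a1 = [1,-1,0,-2,-1]` at `v | 2` (`b₂ = -3`):

* `cm7_isPadicInt_perrinRiouSigma_sq_two_iff` — **`σ_v(L_v(t))² ∈ ℤ₂⟦t⟧ iff `s₂ = 1/4`**: Lemme 2
  («`σ_v(L_v(t)) ∈ t(1 + tR⟦t⟧)`», proved for `49a1` at `2` in `X049CMSigmaSqTwoProofs`) holds for the
  value `s₂ = 1/4` (⇔ `c = 0`), and for NO other value (uniqueness of the sigma-squared pair,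
  `PadicSigmaSqUniquenessProofs`). So the printed CM constant is pinned by the kernel: `s₂ = 1/4` on the
  minimal model — which IS the table's `s₂ = 1/2` on `y² = 4x³ - 35x - 49`, the model `X = 2(x + b₂/12)`
  (`s₂` has weight `2`: `s₂(λ𝓛) = λ⁻²s₂(𝓛)`, `g₂(λ𝓛) = λ⁻⁴g₂(𝓛)`, `35 = 4·(105/12)`).
* `cm7_padicSigmaSq_eq_perrinRiouSigma_sq_two` — `Σ₂(49a1 ⊗ ℚ₂) = σ_v(L_v(t))²` (`s₂ = 1/4`), and
  `cm7_perrinRiouTheta_two` — **`θ_v(L_v(t)) = Δ·Σ₂³·Σ₂³ = Δ·Σ₂⁶`**, `Δ = -343`: the `v | 2` ingredient of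
  Perrin-Riou's height `h_ρ` (p. 56) on `X₀(49)` expressed through the tree's `padicSigmaSq`, binder-free.

What is NOT claimed: the analytic definition of `s₂(𝓛)` and its algebraicity; Lemme 2 for other CM
curves; the height `h_ρ` itself (the normalisation bridge is successor work).

## References
* [Perrin-Riou 1984] B. Perrin-Riou, *Arithmétique des courbes elliptiques et théorie d'Iwasawa*, Mém.
  SMF 17, Ch. III §1.2, p. 53 (`P_v`, `σ_v`, `θ_v`, `s₂`), p. 54 (table; Lemme 2).
  [cite: Perrinriou1984, Ch. III §1.2 Lemme 2]
* [Perrin-Riou 1982] B. Perrin-Riou, *Descente infinie et hauteur p-adique sur une courbe elliptique*,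
  Sém. Théorie des Nombres Paris 1980–81, Progr. Math. 22, §2 (`θ_v(z) = Δz¹²exp(-6s₂z² - ⋯)`, `h_L`).
  [cite: PerrinRiou1982Descente, §2]
* [Mazur–Stein–Tate 2006] Thm. 1.3, §3.1 (the family of formal solutions). [cite: MazurSteinTate2006, Thm. 1.3]
* [Bertrand 1982] D. Bertrand, *Valeurs de fonctions thêta et hauteurs p-adiques*, Progr. Math. 22, p. 2
  (`θ(z) = σ(z)exp(-s₂z²/2)`, `s₂ ∈ F`). [cite: Bertrand1982, §2]
-/

noncomputable section

open PowerSeries Literature.NumberTheory.EllipticCurves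

namespace WeierstrassCurve

variable {p : ℕ} [Fact p.Prime] (V : WeierstrassCurve ℚ_[p])

/-! ### §1. THE normalised odd formal solution with a given constant -/

/-- Existence of a normalised odd formal solution of `x + c = -D(Dσ/σ)` for EVERY constant `c`
(twist the `c = 0` solution by `exp(-(c/2)·log_W²)`). [Mazur–Stein–Tate 2006, §3.1]
[cite: MazurSteinTate2006, Thm. 1.3] -/
theorem exists_isFormallyOdd_satisfiesSigmaODE_const (c : ℚ_[p]) :
    ∃ σ : ℚ_[p]⟦X⟧, constantCoeff σ = 0 ∧ coeff 1 σ = 1 ∧ V.IsFormallyOdd σ ∧ V.SatisfiesSigmaODE σ c := by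
  obtain ⟨σ₀, h0, h1, hodd, hODE⟩ := V.exists_isFormallyOdd_satisfiesSigmaODE_zero
  obtain ⟨h0', h1', hODE'⟩ := hODE.mul_exp_subst h0 h1 (-(c / 2))
  refine ⟨_, h0', h1', hodd.mul_exp_subst (-(c / 2)), ?_⟩
  convert hODE' using 2
  ring

/-- **`formalSigma V c`: THE normalised odd formal solution `σ = t + ⋯ ∈ ℚ_p⟦t⟧` of the sigma equation
`x + c = -D(Dσ/σ)` of `V/ℚ_p`** (exists for every `c`, unique by the Wronskian argument). For a CM curve
and `c = b₂/12 + s₂` this is Perrin-Riou's `σ_v(L_v(t))`; for `c = c_p` (Mazur–Tate's constant) it is the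
`p`-adic sigma function. [Mazur–Stein–Tate 2006, Thm. 1.3 and §3.1; Perrin-Riou 1984, Ch. III §1.2 p. 53]
[cite: MazurSteinTate2006, Thm. 1.3] -/
def formalSigma (c : ℚ_[p]) : ℚ_[p]⟦X⟧ :=
  Classical.choose (V.exists_isFormallyOdd_satisfiesSigmaODE_const c)

/-- The defining properties of `formalSigma V c`. [cite: MazurSteinTate2006, Thm. 1.3] -/
theorem formalSigma_spec (c : ℚ_[p]) :
    constantCoeff (V.formalSigma c) = 0 ∧ coeff 1 (V.formalSigma c) = 1 ∧
      V.IsFormallyOdd (V.formalSigma c) ∧ V.SatisfiesSigmaODE (V.formalSigma c) c :=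
  Classical.choose_spec (V.exists_isFormallyOdd_satisfiesSigmaODE_const c)

variable {V} in
/-- **Uniqueness**: any normalised odd solution with constant `c` IS `formalSigma V c`.
[Mazur–Stein–Tate 2006, Thm. 1.3, Rem. 1.4] [cite: MazurSteinTate2006, Thm. 1.3] -/
theorem eq_formalSigma {σ : ℚ_[p]⟦X⟧} {c : ℚ_[p]} (h0 : constantCoeff σ = 0) (h1 : coeff 1 σ = 1)
    (hodd : V.IsFormallyOdd σ) (hODE : V.SatisfiesSigmaODE σ c) : σ = V.formalSigma c := by
  obtain ⟨g0, g1, godd, gODE⟩ := V.formalSigma_spec c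
  exact V.eq_of_satisfiesSigmaODE_of_isFormallyOdd h0 h1 hodd hODE g0 g1 godd gODE

variable {V} in
/-- **Mazur–Tate's `σ_p` is `formalSigma V c_p`** whenever the Mazur–Tate pair of `V` exists.
[Mazur–Stein–Tate 2006, Thm. 1.3] [cite: MazurSteinTate2006, Thm. 1.3] -/
theorem padicSigma_eq_formalSigma (h : ∃ σ : ℚ_[p]⟦X⟧, ∃ c : ℚ_[p], V.IsMazurTateSigmaPair σ c) :
    V.padicSigma = V.formalSigma V.padicSigmaConst := by
  have hσ := V.isMazurTateSigmaPair_padicSigma h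
  exact eq_formalSigma hσ.constantCoeff_eq hσ.coeff_one_eq hσ.odd hσ.ode

/-! ### §2. Perrin-Riou's `σ_v` and `θ_v` for a given value of `s₂` -/

/-- **Perrin-Riou's CM sigma function read on the formal group, `σ_v(L_v(t)) ∈ t + t²ℚ_p⟦t⟧`**, for the
printed value `s₂` of the CM constant: the normalised odd solution of `-(d/dz)² log σ_v = P_v + s₂`,
`P_v = x + (a₁² + 4a₂)/12`, i.e. of the tree's sigma equation with `c = b₂/12 + s₂`.
[Perrin-Riou 1984, Ch. III §1.2, p. 53 (définition de `σ_v`); Perrin-Riou 1982, §2]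
[cite: Perrinriou1984, Ch. III §1.2 Lemme 2] [cite: PerrinRiou1982Descente, §2] -/
def perrinRiouSigma (s₂ : ℚ_[p]) : ℚ_[p]⟦X⟧ :=
  V.formalSigma (V.b₂ / 12 + s₂)

/-- **Perrin-Riou's theta function `θ_v = Δ·σ_v¹²`** read on the formal group (`θ_v(L_v(t)) ∈ Δt¹² + ⋯`).
[Perrin-Riou 1984, Ch. III §1.2, p. 53; Perrin-Riou 1982, §2
(`θ_v(z) = Δz¹²exp(-6s₂z² - 12Σγ_k z^{2k}/(2k(2k-1)))`)] [cite: Perrinriou1984, Ch. III §1.2 Lemme 2]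
[cite: PerrinRiou1982Descente, §2] -/
def perrinRiouTheta (s₂ : ℚ_[p]) : ℚ_[p]⟦X⟧ :=
  C V.Δ * V.perrinRiouSigma s₂ ^ 12

/-- The defining properties of `σ_v(L_v(t))`: normalised, odd, `x + b₂/12 + s₂ = -D(Dσ_v/σ_v)`.
[cite: Perrinriou1984, Ch. III §1.2 Lemme 2] -/
theorem perrinRiouSigma_spec (s₂ : ℚ_[p]) :
    constantCoeff (V.perrinRiouSigma s₂) = 0 ∧ coeff 1 (V.perrinRiouSigma s₂) = 1 ∧
      V.IsFormallyOdd (V.perrinRiouSigma s₂) ∧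
      V.SatisfiesSigmaODE (V.perrinRiouSigma s₂) (V.b₂ / 12 + s₂) :=
  V.formalSigma_spec _

/-- Unfolding `θ_v = Δ·σ_v¹²`. [cite: Perrinriou1984, Ch. III §1.2 Lemme 2] -/
theorem perrinRiouTheta_def (s₂ : ℚ_[p]) :
    V.perrinRiouTheta s₂ = C V.Δ * V.perrinRiouSigma s₂ ^ 12 := rfl

/-! ### §3. `X₀(49)` at `v | 2`: `s₂ = 1/4` is forced; `θ_v = Δ·Σ₂⁶` -/

section X049

/-- `b₂(49a1) = -3` over `ℚ₂`. [folklore] -/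
private theorem cm7_baseChange_b₂ : (cm7.baseChange ℚ_[2]).b₂ = -3 := by
  rw [b₂, show (cm7.baseChange ℚ_[2]).a₁ = 1 by simp [WeierstrassCurve.baseChange, WeierstrassCurve.map],
    show (cm7.baseChange ℚ_[2]).a₂ = -1 by simp [WeierstrassCurve.baseChange, WeierstrassCurve.map]]
  norm_num

/-- **Perrin-Riou's Lemme 2 at `v | 2` for `X₀(49)` pins `s₂`: `σ_v(L_v(t))² ∈ ℤ₂⟦t⟧ iff `s₂ = 1/4`**
(on the minimal model `[1,-1,0,-2,-1]`; the table value `s₂ = 1/2` on `y² = 4x³ - 35x - 49` transported by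
weight `2`). `⇐`: `(σ_v², 0)` is a sigma-squared pair (`cm7_isMazurTateSigmaSqPair_sq_two`); `⇒`: an
integral `σ_v²` makes `(σ_v², b₂/12 + s₂)` a sigma-squared pair, and the pair of `49a1 ⊗ ℚ₂` is unique
with constant `0`. [Perrin-Riou 1984, Ch. III §1.2 Lemme 2 and table p. 54; Mazur–Tate 1991, Thm. 3.1]
[cite: Perrinriou1984, Ch. III §1.2 Lemme 2] -/
theorem cm7_isPadicInt_perrinRiouSigma_sq_two_iff (s₂ : ℚ_[2]) :
    IsPadicInt ((cm7.baseChange ℚ_[2]).perrinRiouSigma s₂ ^ 2) ↔ s₂ = 1 / 4 := by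
  set E := cm7.baseChange ℚ_[2] with hE
  obtain ⟨h0, h1, hodd, hODE⟩ := E.perrinRiouSigma_spec s₂
  have hb := cm7_baseChange_b₂
  rw [← hE] at hb
  constructor
  · intro hint
    -- `(σ_v², b₂/12 + s₂)` is a sigma-squared pair
    have hpair : E.IsMazurTateSigmaSqPair (E.perrinRiouSigma s₂ ^ 2) (E.b₂ / 12 + s₂) :=
      { constantCoeff_eq := by rw [map_pow, h0, zero_pow two_ne_zero]
        coeff_one_eq := by
          rw [pow_two, coeff_one_mul_eq, coeff_zero_eq_constantCoeff_apply, h0]; ring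
        coeff_two_eq := by
          rw [pow_two, coeff_two_mul_eq, coeff_zero_eq_constantCoeff_apply, h0, h1]; ring
        norm_coeff_le := isPadicInt_iff_coeff.mp hint
        even := hodd.sq
        ode := hODE.sq h0 h1 }
    obtain ⟨σ, g0, g1, godd, gODE, hsq⟩ := cm7_exists_isMazurTateSigmaSqPair_sq_two
    rw [← hE] at godd gODE hsq
    have ha : ‖E.a₁‖ = 1 := by
      rw [hE, show (cm7.baseChange ℚ_[2]).a₁ = 1 by simp [WeierstrassCurve.baseChange, WeierstrassCurve.map],
        norm_one]
    haveI := cm7_isGloballyMinimal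
    haveI : E.IsIntegral ℤ_[2] := by rw [hE]; infer_instance
    have huniq := IsMazurTateSigmaSqPair.unique_two_of_norm_a₁_eq_one E ha hpair hsq
    have hc : E.b₂ / 12 + s₂ = 0 := huniq.2
    rw [hb] at hc
    linear_combination hc
  · rintro rfl
    have hc : E.b₂ / 12 + 1 / 4 = 0 := by rw [hb]; norm_num
    have hODE0 : E.SatisfiesSigmaODE (E.perrinRiouSigma (1 / 4)) 0 := hc ▸ hODE
    have hpair := cm7_isMazurTateSigmaSqPair_sq_two h0 h1 hodd hODE0
    exact isPadicInt_iff_coeff.mpr hpair.norm_coeff_le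

/-- **`Σ₂(X₀(49) ⊗ ℚ₂) = σ_v(L_v(t))²`** with `s₂ = 1/4`: the tree's canonical squared `2`-adic sigma
function is the square of Perrin-Riou's CM sigma function (binder-free).
[Perrin-Riou 1984, Ch. III §1.2; Mazur–Tate 1991, Thm. 3.1] [cite: Perrinriou1984, Ch. III §1.2 Lemme 2] -/
theorem cm7_padicSigmaSq_eq_perrinRiouSigma_sq_two :
    (cm7.baseChange ℚ_[2]).padicSigmaSq = (cm7.baseChange ℚ_[2]).perrinRiouSigma (1 / 4) ^ 2 := by
  obtain ⟨h0, h1, hodd, hODE⟩ := (cm7.baseChange ℚ_[2]).perrinRiouSigma_spec (1 / 4)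
  have hc : (cm7.baseChange ℚ_[2]).b₂ / 12 + 1 / 4 = 0 := by rw [cm7_baseChange_b₂]; norm_num
  rw [hc] at hODE
  exact (cm7_padicSigmaSq_eq_sq_two' h0 h1 hodd hODE).1

/-- **`θ_v(L_v(t)) = Δ·Σ₂⁶` on `X₀(49) ⊗ ℚ₂`** (`Δ = -343`, `s₂ = 1/4`): the `v | 2` local ingredient of
Perrin-Riou's height `h_ρ` [Perrin-Riou 1984, Ch. III §1.2, p. 56] through the tree's `padicSigmaSq`,
with no hypothesis. [cite: Perrinriou1984, Ch. III §1.2 Lemme 2] -/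
theorem cm7_perrinRiouTheta_two :
    (cm7.baseChange ℚ_[2]).perrinRiouTheta (1 / 4) =
      C (-343 : ℚ_[2]) * (cm7.baseChange ℚ_[2]).padicSigmaSq ^ 6 := by
  have hΔ : (cm7.baseChange ℚ_[2]).Δ = -343 := by
    simp [WeierstrassCurve.baseChange, WeierstrassCurve.map, WeierstrassCurve.Δ, WeierstrassCurve.b₂,
      WeierstrassCurve.b₄, WeierstrassCurve.b₆, WeierstrassCurve.b₈]
    norm_num
  rw [perrinRiouTheta_def, hΔ, cm7_padicSigmaSq_eq_perrinRiouSigma_sq_two, ← pow_mul]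

end X049

end WeierstrassCurve
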